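import Mathlib
import Summits.MatrixMultiplication.MatrixMultiplication.Theses.ProbeRankThreshold

/-!
# Route ProbeRankThreshold — support item `RecursionTransfer` (the threshold engine)

From any decomposition `⟨a,a,a⟩ = ∑_{i<r} w_i ⊗ u_i ⊗ v_i` and any `m, n` with `n ≤ a·m` we build
a decomposition of `⟨n,n,n⟩` into `r·m³` triads all of whose probes (legs read as `n × n`
matrices) have rank `≤ a`: take the Kronecker product with the schoolbook decomposition of
`⟨m,m,m⟩` (the probe `u_i ⊗ e_{κμ}` is the block matrix `U_i ⊗ E_{κμ}`) and restrict all six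
indices along the embedding `Fin n ↪ Fin a × Fin m`; restricted probes are submatrices of block
probes and factor through an `n × a` matrix, whence rank `≤ a`. This is the Kronecker-product
recursion `⟨a,a,a⟩ ⊗ ⟨m,m,m⟩ = ⟨am,am,am⟩` (Bläser 2013, §7) followed by zero-padding monotonicity,
written out in coordinates so that the probe ranks can be read off.

Main result: `recursionTransfer_proof : RecursionTransfer` (item stmt-MatrixMultiplication-6604 of
route ProbeRankThreshold). Helpers: `probeRankThreshold_schoolbook_inner_sum` (the schoolbook
identity for `⟨m,m,m⟩` contracted against scalars) and `probeRankThreshold_rank_blockProbe_le`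
(block probes have rank `≤ a`).
-/

namespace Summit.MatrixMultiplication.MatrixMultiplication.Theorems

open scoped BigOperators
open Literature.Computability.AlgebraicComplexity

/-- The schoolbook identity for `⟨m,m,m⟩`, contracted against three scalars: summing the
products of the three block indicators over the block triple `(κ, μ, ν)` leaves exactly the
matrix-multiplication incidence condition on the block coordinates. [folklore] -/
theorem probeRankThreshold_schoolbook_inner_sum {m : ℕ} (A B C : ℂ)
    (b₁ b₂ c₁ c₂ d₁ d₂ : Fin m) :
    ∑ κ : Fin m, ∑ μ : Fin m, ∑ ν : Fin m,
      (A * if b₁ = κ ∧ b₂ = ν then 1 else 0) * (B * if c₁ = κ ∧ c₂ = μ then 1 else 0) *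
        (C * if d₁ = μ ∧ d₂ = ν then 1 else 0)
      = A * B * C * if b₁ = c₁ ∧ c₂ = d₁ ∧ b₂ = d₂ then 1 else 0 := by
  rw [Finset.sum_eq_single c₁]
  · rw [Finset.sum_eq_single d₁]
    · rw [Finset.sum_eq_single d₂]
      · by_cases h1 : b₁ = c₁ <;> by_cases h2 : c₂ = d₁ <;> by_cases h3 : b₂ = d₂ <;>
          simp [h1, h2, h3]
      · intro ν _ hν
        simp [Ne.symm hν]
      · simp
    · intro μ _ hμ
      simp [Ne.symm hμ]
    · simp
  · intro κ _ hκ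
    simp [Ne.symm hκ]
  · simp

/-- A block probe: the `n × n` matrix `(p, q) ↦ f (α p, α q) · [β p = κ] · [β q = ν]` factors
through the `n × a` matrix `(p, x) ↦ [α p = x ∧ β p = κ]`, so its rank is at most `a`. [folklore] -/
theorem probeRankThreshold_rank_blockProbe_le {n a m : ℕ} (α : Fin n → Fin a) (β : Fin n → Fin m)
    (f : Fin a × Fin a → ℂ) (κ ν : Fin m) :
    (Matrix.of fun p q => f (α p, α q) * if β p = κ ∧ β q = ν then 1 else 0).rank ≤ a := by
  let P : Matrix (Fin n) (Fin a) ℂ := Matrix.of fun p x => if α p = x ∧ β p = κ then 1 else 0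
  let G : Matrix (Fin a) (Fin n) ℂ := Matrix.of fun x q => f (x, α q) * if β q = ν then 1 else 0
  have hM : (Matrix.of fun p q => f (α p, α q) * if β p = κ ∧ β q = ν then 1 else 0) = P * G := by
    ext p q
    rw [Matrix.mul_apply, Finset.sum_eq_single (α p)]
    · by_cases h1 : β p = κ <;> by_cases h2 : β q = ν <;> simp [P, G, h1, h2]
    · intro x _ hx
      simp [P, Ne.symm hx]
    · intro h
      exact absurd (Finset.mem_univ _) h
  rw [hM]
  exact (Matrix.rank_mul_le_left P G).trans (Matrix.rank_le_width P)

/-- **RecursionTransfer** (route ProbeRankThreshold, support item stmt-MatrixMultiplication-6604):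
from any decomposition of `⟨a,a,a⟩` into `r` triads and any `m, n` with `n ≤ a·m` one obtains a
decomposition of `⟨n,n,n⟩` into `r·m³` triads all of whose probes have rank `≤ a` (Kronecker
product with the schoolbook decomposition of `⟨m,m,m⟩`, then restriction of all six indices along
`Fin n ↪ Fin (a·m) ≃ Fin a × Fin m`; Bläser 2013, §7 for the Kronecker recursion). [folklore] -/
theorem recursionTransfer_proof :
    Summit.MatrixMultiplication.MatrixMultiplication.Theses.ProbeRankThreshold.RecursionTransfer := by
  unfold Summit.MatrixMultiplication.MatrixMultiplication.Theses.ProbeRankThreshold.RecursionTransfer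
  intro a m n r hnam w u v hdec
  -- pointwise form of the base decomposition
  have hpt : ∀ X Y Z : Fin a × Fin a,
      matMulTensor ℂ a a a X Y Z = ∑ i, w i X * u i Y * v i Z := by
    intro X Y Z
    rw [hdec, Finset.sum_apply, Finset.sum_apply, Finset.sum_apply]
    simp only [triad_apply]
  -- the embedding `Fin n ↪ Fin a × Fin m`, as a pair of coordinate maps
  obtain ⟨α, β, hαβ⟩ : ∃ (α : Fin n → Fin a) (β : Fin n → Fin m),
      ∀ p q : Fin n, p = q ↔ α p = α q ∧ β p = β q := by
    refine ⟨fun p => (finProdFinEquiv.symm (Fin.castLE hnam p)).1,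
      fun p => (finProdFinEquiv.symm (Fin.castLE hnam p)).2, fun p q => ?_⟩
    rw [← Prod.ext_iff, Equiv.apply_eq_iff_eq, (Fin.castLE_injective hnam).eq_iff]
  -- the index set of the new decomposition
  have hcard : Fintype.card (Fin r × Fin m × Fin m × Fin m) = r * m ^ 3 := by
    simp only [Fintype.card_prod, Fintype.card_fin]
    ring
  set e : (Fin r × Fin m × Fin m × Fin m) ≃ Fin (r * m ^ 3) := Fintype.equivFinOfCardEq hcard
  -- the new legs
  obtain ⟨W, hW⟩ : ∃ W : Fin r × Fin m × Fin m × Fin m → Fin n × Fin n → ℂ, ∀ s x,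
      W s x = w s.1 (α x.1, α x.2) * if β x.1 = s.2.1 ∧ β x.2 = s.2.2.2 then 1 else 0 :=
    ⟨_, fun _ _ => rfl⟩
  obtain ⟨U, hU⟩ : ∃ U : Fin r × Fin m × Fin m × Fin m → Fin n × Fin n → ℂ, ∀ s x,
      U s x = u s.1 (α x.1, α x.2) * if β x.1 = s.2.1 ∧ β x.2 = s.2.2.1 then 1 else 0 :=
    ⟨_, fun _ _ => rfl⟩
  obtain ⟨V, hV⟩ : ∃ V : Fin r × Fin m × Fin m × Fin m → Fin n × Fin n → ℂ, ∀ s x,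
      V s x = v s.1 (α x.1, α x.2) * if β x.1 = s.2.2.1 ∧ β x.2 = s.2.2.2 then 1 else 0 :=
    ⟨_, fun _ _ => rfl⟩
  refine ⟨fun j => W (e.symm j), fun j => U (e.symm j), fun j => V (e.symm j), ?_, ?_⟩
  · -- the tensor identity
    have hsum : (∑ j, triad (W (e.symm j)) (U (e.symm j)) (V (e.symm j)))
        = ∑ s, triad (W s) (U s) (V s) :=
      Equiv.sum_comp e.symm (fun s => triad (W s) (U s) (V s))
    rw [hsum]
    funext x y z
    rw [Finset.sum_apply, Finset.sum_apply, Finset.sum_apply]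
    simp only [triad_apply, Fintype.sum_prod_type]
    have hinner : ∀ i : Fin r,
        (∑ κ : Fin m, ∑ μ : Fin m, ∑ ν : Fin m,
          W (i, κ, μ, ν) x * U (i, κ, μ, ν) y * V (i, κ, μ, ν) z)
          = w i (α x.1, α x.2) * u i (α y.1, α y.2) * v i (α z.1, α z.2) *
            if β x.1 = β y.1 ∧ β y.2 = β z.1 ∧ β x.2 = β z.2 then 1 else 0 := by
      intro i
      simp only [hW, hU, hV]
      exact probeRankThreshold_schoolbook_inner_sum _ _ _ _ _ _ _ _ _
    rw [Finset.sum_congr rfl (fun i _ => hinner i), ← Finset.sum_mul, ← hpt]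
    simp only [matMulTensor]
    rw [ite_zero_mul_ite_zero, one_mul]
    refine if_congr ?_ rfl rfl
    rw [hαβ x.1 y.1, hαβ y.2 z.1, hαβ x.2 z.2]
    tauto
  · -- the probe ranks
    intro j
    simp only [hW, hU, hV]
    exact ⟨probeRankThreshold_rank_blockProbe_le α β _ _ _,
      probeRankThreshold_rank_blockProbe_le α β _ _ _,
      probeRankThreshold_rank_blockProbe_le α β _ _ _⟩

end Summit.MatrixMultiplication.MatrixMultiplication.Theorems
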